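import Mathlib
import Summits.NavierStokesRegularity.FluidComputer.SkewCutGalerkinFromTranscripts

/-!
# Skew-cut X0 certificate END-TO-END from the MINIMAL transcript: one shell test with the true head
# inverse and one tail number per end, and the sign of the two head determinants
(instab3 g6 — implementation 1 of the skew-cut X0 certifier, cell `ns-blowup`, 2026-08-27)

HONEST FRAMING (human rulings D-0035/D-0074): nothing here is a claim about Navier–Stokes
blow-up. WHAT THIS IS NOT: not NS evidence. MODEL-lane format bookkeeping; no certificate, printed
number or census word is moved.

`SkewCutGalerkinFromTranscripts.exists_smooth_eigenvector_Ioo_of_transcripts` asks at each end `z`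
for a real left inverse `Br_z` of the head matrix `A_z = [(z − ℓ_j)δ − a_ij]_H` together with three
bounds `α, β_B, β_C`. On a FINITE head these are free: `det A_a · det A_e < 0` makes both heads
invertible, `Br_z := A_z⁻¹`, and crude Frobenius-type bounds always exist (§1). So the minimal
transcript-shaped data per end are ONE real shell test written with the true inverse,
`MU2_z Σ_{S₁∖H} x_i² ≤ Σ_{S₁∖H}(z − ℓ_i − s)x_i² − xᵀ(C A_z⁻¹ B)x` for real `x` vanishing on `H`
(the certifiers' (V5) test `λ_min(Λ_{K+1} − s − sym(C_K N_K B_K)) ≥ MU2_z`, `N_K = (A_z⁻¹)_{KK}`), ONE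
tail number `MU2_z ≤ z − ℓ_i − s` off `S₁`, and the sign `det A_a · det A_e < 0` — exactly the
decisive lines of the certificate logs (`cert_II_R*_K*.json`: `sign_detA`, `mu2`, `tail`).
`exists_smooth_eigenvector_Ioo_of_minimal_transcripts` is the END-TO-END statement from these.

Mathlib + `SkewCutGalerkinFromTranscripts`; no definitions. [folklore]
-/

noncomputable section

namespace Summit.NavierStokesRegularity.FluidComputer.SkewCutGalerkinMinimalTranscripts

open Filter Topology Matrix Finset
open scoped BigOperators InnerProductSpace ComplexConjugate

variable {ι : Type*} [DecidableEq ι]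

/-! ### §1 Crude bounds for real matrices on finite types -/

/-- Row-wise Cauchy–Schwarz: `Σ_j (Σ_m B_jm v_m)² ≤ (Σ_{j,m} B_jm²) Σ_m v_m²`. -/
theorem sq_mulVec_le_frob {m n : Type*} [Fintype m] [Fintype n] (B : m → n → ℝ) (v : n → ℝ) :
    ∑ j, (∑ k, B j k * v k) ^ 2 ≤ (∑ j, ∑ k, B j k ^ 2) * ∑ k, v k ^ 2 := by
  rw [Finset.sum_mul]
  exact Finset.sum_le_sum fun j _ => Finset.sum_mul_sq_le_sq_mul_sq Finset.univ (B j) v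

/-- **The `β_B` bound is free**: `Σ_j (Σ_m B_jm · (−Σ_{l∈nbr m∖H} a_ml x_l))² ≤ β² Σ_{l ∈ H.nbr∖H} x_l²`
with `β² = ‖B‖_F² · Σ_{m∈H} Σ_{l∈nbr m∖H} a_ml²`. -/
theorem betaB_bound (ar : ι → ι → ℝ) (nbr : ι → Finset ι) (H : Finset ι) (B : ↥H → ↥H → ℝ)
    (x : ι → ℝ) :
    ∑ j : ↥H, (∑ m : ↥H, B j m * -∑ l ∈ nbr m \ H, ar m l * x l) ^ 2 ≤
      ((∑ j : ↥H, ∑ m : ↥H, B j m ^ 2) * ∑ m : ↥H, ∑ l ∈ nbr m \ H, ar m l ^ 2) *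
        ∑ l ∈ H.biUnion nbr \ H, x l ^ 2 := by
  have h1 := sq_mulVec_le_frob B (fun m : ↥H => -∑ l ∈ nbr m \ H, ar m l * x l)
  have hF : 0 ≤ ∑ j : ↥H, ∑ m : ↥H, B j m ^ 2 :=
    Finset.sum_nonneg fun j _ => Finset.sum_nonneg fun m _ => sq_nonneg _
  -- each inner coupling is bounded by Cauchy–Schwarz and the shell sum
  have h2 : ∑ m : ↥H, (-∑ l ∈ nbr m \ H, ar m l * x l) ^ 2 ≤
      (∑ m : ↥H, ∑ l ∈ nbr m \ H, ar m l ^ 2) * ∑ l ∈ H.biUnion nbr \ H, x l ^ 2 := by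
    rw [Finset.sum_mul]
    refine Finset.sum_le_sum fun m _ => ?_
    rw [neg_sq]
    refine (Finset.sum_mul_sq_le_sq_mul_sq (nbr m \ H) (ar m) x).trans ?_
    refine mul_le_mul_of_nonneg_left ?_ (Finset.sum_nonneg fun l _ => sq_nonneg _)
    have hsub : nbr m \ H ⊆ H.biUnion nbr \ H := fun l hl => by
      have hl' := Finset.mem_sdiff.mp hl
      exact Finset.mem_sdiff.mpr ⟨Finset.mem_biUnion.mpr ⟨m, m.2, hl'.1⟩, hl'.2⟩
    exact Finset.sum_le_sum_of_subset_of_nonneg hsub fun l _ _ => sq_nonneg _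
  calc ∑ j : ↥H, (∑ m : ↥H, B j m * -∑ l ∈ nbr m \ H, ar m l * x l) ^ 2
      ≤ (∑ j : ↥H, ∑ m : ↥H, B j m ^ 2) * ∑ m : ↥H, (-∑ l ∈ nbr m \ H, ar m l * x l) ^ 2 := h1
    _ ≤ (∑ j : ↥H, ∑ m : ↥H, B j m ^ 2) *
        ((∑ m : ↥H, ∑ l ∈ nbr m \ H, ar m l ^ 2) * ∑ l ∈ H.biUnion nbr \ H, x l ^ 2) :=
        mul_le_mul_of_nonneg_left h2 hF
    _ = _ := by ring

omit [DecidableEq ι] in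
/-- **The `β_C` bound is free**: `Σ_{i∈U} (Σ_j a_ij (B v)_j)² ≤ (Σ_{i∈U} Σ_j a_ij²) ‖B‖_F² Σ v²`. -/
theorem betaC_bound (ar : ι → ι → ℝ) (H U : Finset ι) (B : ↥H → ↥H → ℝ) (v : ↥H → ℝ) :
    ∑ i ∈ U, (∑ j : ↥H, ar i j * ∑ m : ↥H, B j m * v m) ^ 2 ≤
      ((∑ i ∈ U, ∑ j : ↥H, ar i j ^ 2) * ∑ j : ↥H, ∑ m : ↥H, B j m ^ 2) * ∑ i : ↥H, v i ^ 2 := by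
  have h1 : ∀ i ∈ U, (∑ j : ↥H, ar i j * ∑ m : ↥H, B j m * v m) ^ 2 ≤
      (∑ j : ↥H, ar i j ^ 2) * ∑ j : ↥H, (∑ m : ↥H, B j m * v m) ^ 2 := fun i _ =>
    Finset.sum_mul_sq_le_sq_mul_sq Finset.univ (fun j : ↥H => ar i j) _
  have h2 := sq_mulVec_le_frob B v
  have hBv : 0 ≤ ∑ j : ↥H, (∑ m : ↥H, B j m * v m) ^ 2 := Finset.sum_nonneg fun j _ => sq_nonneg _
  calc ∑ i ∈ U, (∑ j : ↥H, ar i j * ∑ m : ↥H, B j m * v m) ^ 2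
      ≤ ∑ i ∈ U, (∑ j : ↥H, ar i j ^ 2) * ∑ j : ↥H, (∑ m : ↥H, B j m * v m) ^ 2 := Finset.sum_le_sum h1
    _ = (∑ i ∈ U, ∑ j : ↥H, ar i j ^ 2) * ∑ j : ↥H, (∑ m : ↥H, B j m * v m) ^ 2 := by
        rw [Finset.sum_mul]
    _ ≤ (∑ i ∈ U, ∑ j : ↥H, ar i j ^ 2) * ((∑ j, ∑ k, B j k ^ 2) * ∑ k, v k ^ 2) :=
        mul_le_mul_of_nonneg_left h2 (Finset.sum_nonneg fun i _ => Finset.sum_nonneg fun j _ => sq_nonneg _)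
    _ = _ := by ring

/-- On a finite head, the true inverse of an invertible head matrix satisfies the functional
left-inverse identity of `SkewCutGalerkinFromTranscripts`. -/
theorem leftInverse_fun_of_det_ne_zero (ℓ : ι → ℝ) (ar : ι → ι → ℝ) (H : Finset ι) (z : ℝ)
    (hdet : (Matrix.of fun i j : ↥H => (if i = j then z - ℓ j else 0) - ar i j).det ≠ 0) :
    ∀ (v : ↥H → ℝ) (j : ↥H),
      ∑ m : ↥H, (Matrix.of fun i j : ↥H => (if i = j then z - ℓ j else 0) - ar i j)⁻¹ j m *
        ((z - ℓ m) * v m - ∑ l : ↥H, ar m l * v l) = v j := by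
  intro v j
  set A : Matrix ↥H ↥H ℝ := Matrix.of fun i j : ↥H => (if i = j then z - ℓ j else 0) - ar i j with hA
  have hunit : IsUnit A.det := isUnit_iff_ne_zero.mpr hdet
  have hinv : A⁻¹ * A = 1 := Matrix.nonsing_inv_mul A hunit
  have hv : (A⁻¹ * A) *ᵥ v = v := by rw [hinv, Matrix.one_mulVec]
  rw [← Matrix.mulVec_mulVec] at hv
  have hAv : ∀ m : ↥H, (A *ᵥ v) m = (z - ℓ m) * v m - ∑ l : ↥H, ar m l * v l := by
    intro m
    rw [Matrix.mulVec, dotProduct]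
    simp only [hA, Matrix.of_apply, sub_mul, Finset.sum_sub_distrib, ite_mul, zero_mul]
    rw [Finset.sum_ite_eq Finset.univ m]
    simp
  have hj := congr_fun hv j
  rw [Matrix.mulVec, dotProduct] at hj
  simp only [hAv] at hj
  exact hj

/-! ### §2 END-TO-END from the minimal transcript -/

/-- **SKEW-CUT X0 CERTIFICATE, END-TO-END FROM THE MINIMAL TRANSCRIPT.** Structure as in
`SkewCutGalerkinFromTranscripts.exists_smooth_eigenvector_Ioo_of_transcripts` (Hilbert basis, levels,
real banded first-order matrix with the chain's structural bounds, section pairing, head/next cubes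
with locality, sections). TRANSCRIPT per end `z ∈ {a, e}`: ONE real shell test written with the TRUE
inverse of the head matrix `A_z = [(z − ℓ_j)δ − a_ij]_H`,
`MU2_z Σ_{S₁∖H} x_i² ≤ Σ_{S₁∖H}(z − ℓ_i − s)x_i² − xᵀ(C A_z⁻¹ B)x` (real `x` vanishing on `H`,
`MU2_z > 0`), ONE tail number `MU2_z ≤ z − ℓ_i − s` off `S₁`; and `det A_a · det A_e < 0`. CONCLUSION:
a bounded `T` with matrix `t`, an eigenvalue `λ ∈ (a, e)` with a unit `H^∞` eigenvector. (The left
inverses and their bounds asked by the previous file are supplied by `A_z⁻¹` and §1.) -/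
theorem exists_smooth_eigenvector_Ioo_of_minimal_transcripts {𝕜 : Type*} [RCLike 𝕜]
    {H : Type*} [NormedAddCommGroup H] [InnerProductSpace 𝕜 H] [CompleteSpace H]
    (b : HilbertBasis ι 𝕜 H)
    -- structure: levels, base point, resolvent symbol
    (ℓ : ι → ℝ) (hℓ : ∀ i, ℓ i ≤ 0) (x₀ : ℝ) (d : lp (fun _ : ι => 𝕜) ⊤)
    (hd : ∀ i, d i * ((x₀ : 𝕜) - (ℓ i : 𝕜)) = 1) (hd0 : Tendsto (fun i => ‖d i‖) cofinite (𝓝 0))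
    -- structure: the first-order matrix (relative bound `t`, real entries `ar`), Schur sums, band
    (t : ι → ι → 𝕜) {R₀ C₀ : ℝ} (hrow : ∀ i, Summable fun j => ‖t i j‖)
    (hR : ∀ i, ∑' j, ‖t i j‖ ≤ R₀) (hcol : ∀ j, Summable fun i => ‖t i j‖)
    (hC₀ : ∀ j, ∑' i, ‖t i j‖ ≤ C₀) (hR0 : 0 ≤ R₀) (hC0 : 0 ≤ C₀) (hq : R₀ * C₀ < 1)
    (nbr : ι → Finset ι) (hsymm : ∀ i j, j ∈ nbr i ↔ i ∈ nbr j) {W : ℕ}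
    (hW : ∀ i, (nbr i).card ≤ W) (ht0 : ∀ i j, j ∉ nbr i → t i j = 0)
    (ar : ι → ι → ℝ) (har : ∀ i j, t i j * ((x₀ : 𝕜) - (ℓ j : 𝕜)) = (ar i j : 𝕜))
    (wgt : ι → ℝ) (hw0 : ∀ i, 0 ≤ wgt i) (hwℓ : ∀ i, wgt i ^ 2 ≤ 1 + |ℓ i|) {Kg : ℝ}
    (hK : 0 ≤ Kg) (ha : ∀ i j, j ∈ nbr i → ‖t i j * ((x₀ : 𝕜) - (ℓ j : 𝕜))‖ ≤ Kg * wgt j)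
    {L : ℝ} (hLnn : 0 ≤ L) (hL : ∀ i j, j ∈ nbr i → wgt i ≤ L * wgt j)
    {M : ℝ} (hM : ∀ i, ‖d i‖ * wgt i ≤ M)
    -- structure: the section pairing bound
    {s : ℝ}
    (hA : ∀ (G : Finset ι) (u : ι → 𝕜),
      RCLike.re (∑ i ∈ G, ∑ j ∈ G, conj (u i) * (t i j * ((x₀ : 𝕜) - (ℓ j : 𝕜))) * u j) ≤
        s * ∑ i ∈ G, ‖u i‖ ^ 2)
    -- structure: head cube, next cube, locality, the sections
    (Hd S₁ : Finset ι) (hHS : Hd ⊆ S₁) (hloc : ∀ i ∈ Hd, nbr i ⊆ S₁)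
    (F : ℕ → Finset ι) (hF : Monotone F) (hFex : ∀ i, ∃ n, i ∈ F n) (hFS : ∀ n, S₁ ⊆ F n)
    -- the bracket
    {a e : ℝ} (hae : a < e) (hex₀ : e ≤ x₀)
    -- MINIMAL TRANSCRIPT at the end `a`: shell test with `A_a⁻¹`, tail number
    {MU2a : ℝ} (hMU2a : 0 < MU2a)
    (hshella : ∀ x : ι → ℝ, (∀ i ∈ Hd, x i = 0) →
      MU2a * ∑ i ∈ S₁ \ Hd, x i ^ 2 ≤ ∑ i ∈ S₁ \ Hd, (a - ℓ i - s) * x i ^ 2 -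
        ∑ i ∈ Hd.biUnion nbr \ Hd, (∑ j : ↥Hd, ar i j * ∑ m : ↥Hd,
          (Matrix.of fun i j : ↥Hd => (if i = j then a - ℓ j else 0) - ar i j)⁻¹ j m *
            ∑ l ∈ nbr m \ Hd, ar m l * x l) * x i)
    (htaila : ∀ i ∉ S₁, MU2a ≤ a - ℓ i - s)
    -- MINIMAL TRANSCRIPT at the end `e`
    {MU2e : ℝ} (hMU2e : 0 < MU2e)
    (hshelle : ∀ x : ι → ℝ, (∀ i ∈ Hd, x i = 0) →
      MU2e * ∑ i ∈ S₁ \ Hd, x i ^ 2 ≤ ∑ i ∈ S₁ \ Hd, (e - ℓ i - s) * x i ^ 2 -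
        ∑ i ∈ Hd.biUnion nbr \ Hd, (∑ j : ↥Hd, ar i j * ∑ m : ↥Hd,
          (Matrix.of fun i j : ↥Hd => (if i = j then e - ℓ j else 0) - ar i j)⁻¹ j m *
            ∑ l ∈ nbr m \ Hd, ar m l * x l) * x i)
    (htaile : ∀ i ∉ S₁, MU2e ≤ e - ℓ i - s)
    -- the sign of the two head determinants
    (hsign : (Matrix.of fun i j : ↥Hd => (if i = j then a - ℓ j else 0) - ar i j).det *
      (Matrix.of fun i j : ↥Hd => (if i = j then e - ℓ j else 0) - ar i j).det < 0) :
    ∃ T : H →L[𝕜] H, (∀ i j, ⟪b i, T (b j)⟫_𝕜 = t i j) ∧ ‖T‖ ≤ Real.sqrt (R₀ * C₀) ∧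
      ∃ lam ∈ Set.Ioo a e, ∃ v : H, ‖v‖ = 1 ∧
        (∀ i, (ℓ i : 𝕜) * ⟪b i, v⟫_𝕜 +
            ∑ j ∈ nbr i, (t i j * ((x₀ : 𝕜) - (ℓ j : 𝕜))) * ⟪b j, v⟫_𝕜 = (lam : 𝕜) * ⟪b i, v⟫_𝕜) ∧
        ∀ s : ℕ, Summable fun i => wgt i ^ (2 * s) * ‖⟪b i, v⟫_𝕜‖ ^ 2 := by
  -- both heads are invertible
  set Aa : Matrix ↥Hd ↥Hd ℝ := Matrix.of fun i j : ↥Hd => (if i = j then a - ℓ j else 0) - ar i j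
    with hAa
  set Ae : Matrix ↥Hd ↥Hd ℝ := Matrix.of fun i j : ↥Hd => (if i = j then e - ℓ j else 0) - ar i j
    with hAe
  have hdeta : Aa.det ≠ 0 := fun h => by rw [h, zero_mul] at hsign; exact lt_irrefl _ hsign
  have hdete : Ae.det ≠ 0 := fun h => by rw [h, mul_zero] at hsign; exact lt_irrefl _ hsign
  -- the true inverses as the left-inverse data, with free bounds
  set Bra : ↥Hd → ↥Hd → ℝ := fun j m => Aa⁻¹ j m with hBra
  set Bre : ↥Hd → ↥Hd → ℝ := fun j m => Ae⁻¹ j m with hBre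
  have hBra' := leftInverse_fun_of_det_ne_zero ℓ ar Hd a hdeta
  have hBre' := leftInverse_fun_of_det_ne_zero ℓ ar Hd e hdete
  -- Frobenius norms and the crude constants
  set fa : ℝ := ∑ j : ↥Hd, ∑ m : ↥Hd, Bra j m ^ 2 with hfa
  set fe : ℝ := ∑ j : ↥Hd, ∑ m : ↥Hd, Bre j m ^ 2 with hfe
  set gB : ℝ := ∑ m : ↥Hd, ∑ l ∈ nbr m \ Hd, ar m l ^ 2 with hgB
  set gC : ℝ := ∑ i ∈ Hd.biUnion nbr \ Hd, ∑ j : ↥Hd, ar i j ^ 2 with hgC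
  have hfa0 : 0 ≤ fa := Finset.sum_nonneg fun j _ => Finset.sum_nonneg fun m _ => sq_nonneg _
  have hfe0 : 0 ≤ fe := Finset.sum_nonneg fun j _ => Finset.sum_nonneg fun m _ => sq_nonneg _
  have hgB0 : 0 ≤ gB := Finset.sum_nonneg fun m _ => Finset.sum_nonneg fun l _ => sq_nonneg _
  have hgC0 : 0 ≤ gC := Finset.sum_nonneg fun i _ => Finset.sum_nonneg fun j _ => sq_nonneg _
  refine SkewCutGalerkinFromTranscripts.exists_smooth_eigenvector_Ioo_of_transcripts b ℓ hℓ x₀ d hd hd0 t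
    hrow hR hcol hC₀ hR0 hC0 hq nbr hsymm hW ht0 ar har wgt hw0 hwℓ hK ha hLnn hL hM hA Hd S₁ hHS hloc F
    hF hFex hFS hae hex₀
    Bra hBra' (Real.sqrt_nonneg fa) (Real.sqrt_nonneg (fa * gB)) (Real.sqrt_nonneg (gC * fa))
    (fun v => by rw [Real.sq_sqrt hfa0]; exact sq_mulVec_le_frob Bra v)
    (fun x => by rw [Real.sq_sqrt (mul_nonneg hfa0 hgB0)]; exact betaB_bound ar nbr Hd Bra x)
    (fun v => by rw [Real.sq_sqrt (mul_nonneg hgC0 hfa0)]; exact betaC_bound ar Hd _ Bra v)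
    hMU2a hshella htaila
    Bre hBre' (Real.sqrt_nonneg fe) (Real.sqrt_nonneg (fe * gB)) (Real.sqrt_nonneg (gC * fe))
    (fun v => by rw [Real.sq_sqrt hfe0]; exact sq_mulVec_le_frob Bre v)
    (fun x => by rw [Real.sq_sqrt (mul_nonneg hfe0 hgB0)]; exact betaB_bound ar nbr Hd Bre x)
    (fun v => by rw [Real.sq_sqrt (mul_nonneg hgC0 hfe0)]; exact betaC_bound ar Hd _ Bre v)
    hMU2e hshelle htaile hsign

end Summit.NavierStokesRegularity.FluidComputer.SkewCutGalerkinMinimalTranscripts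

end
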